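import Summits.BirchSwinnertonDyer.BirchSwinnertonDyer.Theorems.AlignedTransportAtTwoBSDOfMainConjectureRankOneAtTwoLeadingTermAlgebra
import Summits.BirchSwinnertonDyer.Rank1Residual.F1Sign2.SchneiderPerrinRiouAtTwo
import Literature.NumberTheory.EllipticCurves.CanonicalPAdicHeightSqExistenceProofs
import Literature.NumberTheory.EllipticCurves.IwasawaLeadingTermProofs
import HarnessLib

/-!
# Route `AlignedTransportAtTwo`, crux C3′ `BSDOfMainConjectureRankOneAtTwo` (stmt-BirchSwinnertonDyer-23008), line `birth` v2 — the crux BY NAME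
# from the two NAMED cell statements `F1Sign2.SchneiderLeadingTermAtTwoSq` (T-23008-a) and `F1Sign2.PerrinRiouComparisonAtTwo` (T-23008-b,
# norm form) and three published facts

HONEST FRAMING (cell `bsd-f1-sign2`, lead seat `bsd-line-att-p1` g2). BSD is NOT proved; C3′ is NOT closed: its two analytic inputs at `p = 2` are
OPEN cell conjectures, filed by the typer (p598374, REF1 §58/§58b CLEARED) with bodies = this seat's typing draft (T-23008-b in the weaker NORM
form recommended by this seat). THEOREMS ONLY; nothing asserted. This is the by-name closure of stub L and the composition of the reshaped
skeleton `Cruxes/BSDOfMainConjectureRankOneAtTwo/Lines/birth.lean` v2; `--supports stmt-BirchSwinnertonDyer-23008`.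

MECHANISM (the MC-route): GZK ⇒ `rank = 1`; the modular datum gives the conductor-level newform `f_E` and `ϖ > 0` with `ϖ·Ω_E = Ω⁺_f`; the
Mazur–Tate `Σ²` fact inhabits the height receptacle (`Dh.IsCanonicalSq`); Mazur's `2`-adic main conjecture (a binder OF THE CRUX) at the existing
cyclotomic datum gives a generator `g` with `ι g = ϖ·L₂(f_E, α)`, so `ord_T g = ord_T L₂ = 1 = rank` (the crux's simple-zero binder) and
T-23008-a (2) yields `Reg₂(Dh) ≠ 0`; T-23008-a (2)+(3) packaged as the adapter's Schneider-shaped law (p594549) gives the `∃u` leading-term law with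
`A = ϖ·[T¹]L₂·log₂5`, `B = (1−α⁻¹)²·Reg₂(Dh)` (`B ≠ 0` by `exists_unit_one_sub_unitRoot_inv`); T-23008-b is the NORM-form comparison with the same
`A, B`; the mixed-currency L3 (p598021 §7) concludes — `tors²`, `∏c_v`, `(1−α⁻¹)²`, `log₂5`, the height currency all cancel.
[cite: BalakrishnanMullerStein2015, Thm. 1.7] [cite: PerrinRiou1987] [cite: Disegni2017, Thm. B] [cite: MazurTate1991, Thm. 3.1] [cite: Miller2011LMS, Def. 1.1]
-/

set_option autoImplicit false
-- the route's Theorems namespace repeats a component by design (summit = sub-problem, D-0017).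
set_option linter.dupNamespace false

noncomputable section

open scoped Classical MatrixGroups ModularForm

open CongruenceSubgroup WeierstrassCurve Literature.NumberTheory.EllipticCurves
  Literature.NumberTheory.EllipticCurves.ModularForms Literature.NumberTheory.EllipticCurves.Greenberg1999
  Summit.BirchSwinnertonDyer.Rank1Residual.F1Sign2
  Summit.BirchSwinnertonDyer.BirchSwinnertonDyer.Theorems.Rank1ResidualX1Defs
  Summit.BirchSwinnertonDyer.BirchSwinnertonDyer.Theorems.AlignedTransportAtTwoOrderTransfer
  Summit.BirchSwinnertonDyer.BirchSwinnertonDyer.Theorems.AlignedTransportAtTwoLeadingTermAlgebra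

namespace Summit.BirchSwinnertonDyer.BirchSwinnertonDyer.Theorems.AlignedTransportAtTwoLeadingTermFinal

/-- **C3′ from the NAMED `p = 2` statements (CONDITIONAL; closes nothing).** `SchneiderLeadingTermAtTwoSq` (Schneider/BMS leading term of the
characteristic series at `2` over the `Σ²` height receptacle; theorem at odd `p`, OPEN at `2`) → `PerrinRiouComparisonAtTwo` (Perrin-Riou's
rank-one comparison at `2`, norm form; OPEN at `2`) → Gross–Zagier–Kolyvagin → modularity (parametrisation datum) → the Mazur–Tate `Σ²` fact →
`BSDOfMainConjectureRankOneAtTwo`. BSD is not proved; the crux stays open modulo exactly these two named conjectures and three published facts.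
[cite: BalakrishnanMullerStein2015, Thm. 1.7] [cite: PerrinRiou1987] [cite: Miller2011LMS, Def. 1.1] -/
theorem bsdOfMainConjectureRankOneAtTwo_of_schneiderAtTwo_of_perrinRiouAtTwo (ha : SchneiderLeadingTermAtTwoSq) (hb : PerrinRiouComparisonAtTwo)
    (hGZK : rank_eq_analyticRank_of_analyticRank_le_one) (hmod : nonempty_modularParametrizationData)
    (hMT : mazurTate_sigmaSq_existsUnique_two) :
    Summit.BirchSwinnertonDyer.BirchSwinnertonDyer.Theses.AlignedTransportAtTwo.BSDOfMainConjectureRankOneAtTwo := by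
  intro W _ _ _ hord ht _ hr hL hMC
  haveI : NeZero (W.conductorNorm ℤ) := ⟨(W.conductorNorm_pos_holds).ne'⟩
  -- rank one (GZK)
  obtain ⟨hrank, -⟩ := hGZK W (le_of_eq hr)
  have hrank1 : W.mordellWeilRank = 1 := by rw [hrank, hr]
  -- the conductor-level newform and its period ratio (modularity datum)
  obtain ⟨Dm⟩ := hmod W
  obtain ⟨ϖ, hϖpos, hϖ, -⟩ := Dm.exists_rat_mul_realPeriodRat_eq_plusPeriod
  have hf : IsNewformOf W Dm.f := Dm.isNewformOf
  have hL1 : (padicLFunction Dm.f (unitRoot W 2 : ℚ_[2])).order = 1 := hL Dm.f hf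
  -- THE canonical `2`-adic height (Σ² receptacle)
  obtain ⟨Dh, hDh⟩ := exists_isCanonicalSq_two hMT W hord.1 hord.2
  -- (a) packaged as the adapter's Schneider-shaped law, with `LOG = log₂ 5`, `B = ε₂ · Reg₂(Dh)`
  set ε : ℚ_[2] := (1 - (unitRoot W 2 : ℚ_[2])⁻¹) ^ 2 with hε
  have hS : ∀ (κ : ZpExtension ℚ 2) (γ : Field.absoluteGaloisGroup ℚ),
      κ.IsCyclotomic → κ.IsTopGenerator γ → IsCyclotomicVariable 2 γ →
      ∀ (D : W.SelmerDualData κ γ) [Module.Finite (IwasawaAlgebra 2) D.X], D.IsTorsion →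
      ∀ fE : IwasawaAlgebra 2, D.charIdeal = Ideal.span {fE} → fE.order = (W.mordellWeilRank : ℕ∞) →
        ∃ u : ℤ_[2]ˣ, ((PowerSeries.coeff 1 fE : ℤ_[2]) : ℚ_[2]) * padicLog 2 (cyclotomicGenerator 2) *
            (W.torsionOrder : ℚ_[2]) ^ 2 =
          ((u : ℤ_[2]) : ℚ_[2]) * (Nat.card (AddCommGroup.primaryComponent W.sha 2) : ℚ_[2]) * (ε * padicRegulator Dh) *
            (W.tamagawaProduct : ℚ_[2]) := by
    intro κ γ hκ hγ hγ' D _ hX fE hchar hordfE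
    obtain ⟨-, hiff, h3⟩ := ha W hord.1 hord.2 κ γ hκ hγ hγ' D hX fE hchar Dh hDh
    obtain ⟨hSch, hfin⟩ := hiff.mp hordfE
    obtain ⟨u, hu⟩ := h3 hSch hfin
    rw [hrank1, pow_one] at hu
    exact ⟨u, by rw [hu]; ring⟩
  -- `Reg₂(Dh) ≠ 0` from (a)(2) at the main-conjecture generator
  have hSch : SchneiderConjecture Dh := by
    obtain ⟨κ, hκ, γ, hγ, hγ'⟩ := exists_isCyclotomic_isTopGenerator_isCyclotomicVariable_holds 2
    obtain ⟨D⟩ := W.nonempty_selmerDualData_holds κ γ hγ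
    haveI : Module.Finite (IwasawaAlgebra 2) D.X := D.module_finite_holds hγ
    obtain ⟨hX, g, hchar, hι⟩ := hMC κ γ hκ hγ hγ' Dm.f hf ϖ hϖ D
    have hc : (ϖ : ℚ_[2]) ≠ 0 := by exact_mod_cast hϖpos.ne'
    have hordg : g.order = (W.mordellWeilRank : ℕ∞) := by
      rw [← order_eq_order_of_iwasawaToPowerSeries_eq_C_mul 2 hc hι, hL1, hrank1]; rfl
    obtain ⟨-, hiff, -⟩ := ha W hord.1 hord.2 κ γ hκ hγ hγ' D hX g hchar Dh hDh
    exact (hiff.mp hordg).1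
  -- `B = ε₂ · Reg₂ ≠ 0`
  have hε0 : ε ≠ 0 := by
    obtain ⟨u₂, hu₂⟩ := exists_unit_one_sub_unitRoot_inv 2 W hord
    have hN : (W.reductionPointCount 2 : ℚ_[2]) ≠ 0 := by exact_mod_cast (W.reductionPointCount_pos 2).ne'
    have hu1 : ‖((u₂ : ℤ_[2]) : ℚ_[2])‖ = 1 := PadicInt.isUnit_iff.mp u₂.isUnit
    have hu0 : ((u₂ : ℤ_[2]) : ℚ_[2]) ≠ 0 := by
      rw [← norm_pos_iff, hu1]; exact one_pos
    rw [hε, hu₂]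
    exact pow_ne_zero 2 (mul_ne_zero hu0 hN)
  have hB : ε * padicRegulator Dh ≠ 0 := mul_ne_zero hε0 hSch
  -- the leading-term law (adapter) and the comparison law (b), same `A`, `B`
  have hLT := leadingTermLaw_of_schneiderShape_of_mazurMainConjecture W 2 hf hϖ hS hrank1 hL1 hMC
  obtain ⟨q, hq1, hq2⟩ := hb W hord ht hr Dm.f hf ϖ hϖ Dh hDh hSch
  exact bsdp_of_leadingTerm_of_normComparison W 2 hGZK (le_of_eq hr) hB hLT ⟨q, hq1, hq2⟩

end Summit.BirchSwinnertonDyer.BirchSwinnertonDyer.Theorems.AlignedTransportAtTwoLeadingTermFinal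

end
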